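import Summits.Ventures.HSemireg.WedgeHankelRecurrenceGaussHoffmanWielandtCoefficients

/-!
# Venture HSemireg — **THE RESULTANT OF `T_{n+2}` AND `T_n`** (Mathlib's Chebyshev polynomials over `ℤ`): from `T_{n+2} = 2X·T_{n+1} − T_n` and N406,
# **`Res_{(n+2,n)}(T_{n+2}, T_n) = 2^n · T_n(0) · (−1)^{n(n+1)∕2} 2^{n(n−1)}`**, hence **`= 0` for odd `n`** (`0` is a common zero) and
# **`Res_{(2m+2,2m)}(T_{2m+2}, T_{2m}) = 2^{2m} (−1)^m (−1)^{m(2m+1)} 2^{2m(2m−1)}`** for even `n = 2m` (`T_{2m}(0) = (−1)^m`); the same recursion for `U`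

HONEST FRAMING. Part of the Lean index of the computation cell `pub-hsemireg` (seat p10 gen 47, Sunday typer «UNIFORM-IN-n»).  Integer polynomial algebra only (Mathlib `Polynomial.resultant`,
`Polynomial.Chebyshev`); no variety, no cohomology theory, no sheaf, no Ext group and no semiregularity map is constructed here; nothing here says that HC / HC_CM / HC_AV holds; no Literature
fact (unproved `Prop`) is declared or used.  Custodian versions as in `WedgeHankelSiegelIdeal` (1/3).
SOURCES (cited).  K. Dilcher, K. B. Stolarsky, *Resultants and discriminants of Chebyshev and related polynomials*, Trans. Amer. Math. Soc. 357 (2005) 965–981, Thm 2 (general `Res(T_m, T_n)`; here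
the case `m = n + 2`); I. Schur 1931 §1.  The displayed recursion is the COROLLARY typed here of N406's step.
PROOF TYPED HERE.  `Res_{(n+2,n)}(T_{n+1}·2X + T_n·(−1), T_n) = Res_{(n+2,n)}(2X·T_{n+1}, T_n)` (Mathlib `resultant_add_mul_left`) `= Res_{(1,n)}(2X, T_n) Res_{(n+1,n)}(T_{n+1}, T_n)`
(`resultant_mul_left`, degrees `1 + (n+1)`), `Res_{(1,n)}(C 2 · X, T_n) = 2^n T_n(0)` (`resultant_C_mul_left`, `resultant_X_sub_C_left` at `r = 0`), N406 `chebyshevT_resultant`; Mathlib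
`T_eval_zero_of_odd ∕ T_eval_two_mul_zero`.
DEDUP DISCLOSURE (`rg -n -i 'chebyshev.*gap|T_resultant_gap' Summits/Ventures/HSemireg`, 2026-09-04): N406 (consecutive); 0 hits for the 4 names below.

WHAT IS IN THE TREE.  N406 `chebyshevT_resultant`, `chebyshevU_resultant`, `chebyshevT_natDegree_coeff`, `chebyshevU_natDegree_coeff`; Mathlib `T_add_two`, `U_add_two`, `T_eval_zero_of_odd`,
`T_eval_two_mul_zero`, `U_eval_zero_of_odd`, `U_eval_two_mul_zero`.
THIS FILE (namespace `Summit.Ventures.HSemireg.Wedge.HankelOuter` continued; CHAINED on N429 (import only); 0 definitions):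
* §1195 **`chebyshevT_resultant_gap_two`** (`Res_{(n+2,n)}(T_{n+2}, T_n) = 2^n T_n(0) · Res_{(n+1,n)}(T_{n+1}, T_n)` with N406 inserted), `chebyshevT_resultant_gap_two_odd` (`= 0`),
  `chebyshevT_resultant_gap_two_even`, **`chebyshevU_resultant_gap_two`**.
CAVEATS.  Formal degrees explicit; `T_n(0)` kept as `(T ℤ n).eval 0` in the general statement.  Nothing Ext-side.  New names only.
-/

open Module Polynomial
open scoped Matrix Polynomial

namespace Summit.Ventures.HSemireg.Wedge.HankelOuter

/-! ## §1195. `Res(T_{n+2}, T_n)` and `Res(U_{n+2}, U_n)` -/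

/-- **`Res_{(n+2,n)}(T_{n+2}, T_n) = 2^n · T_n(0) · (−1)^{n(n+1)∕2} 2^{n(n−1)}`** over `ℤ`. [Dilcher–Stolarsky 2005 Thm 2 (case `m = n+2`); this file, §1195] -/
theorem chebyshevT_resultant_gap_two (n : ℕ) :
    (Polynomial.Chebyshev.T ℤ ((n : ℤ) + 2)).resultant (Polynomial.Chebyshev.T ℤ (n : ℤ)) (n + 2) n =
      2 ^ n * (Polynomial.Chebyshev.T ℤ (n : ℤ)).eval 0 * ((-1) ^ (n * (n + 1) / 2) * 2 ^ (n * (n - 1))) := by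
  obtain ⟨hd1, -⟩ := chebyshevT_natDegree_coeff n
  have hdn : (Polynomial.Chebyshev.T ℤ (n : ℤ)).natDegree ≤ n := by rw [Polynomial.Chebyshev.natDegree_T]; omega
  have h1 : Polynomial.Chebyshev.T ℤ ((n : ℤ) + 2) = (C (2 : ℤ) * Polynomial.X) * Polynomial.Chebyshev.T ℤ ((n : ℤ) + 1) + Polynomial.Chebyshev.T ℤ (n : ℤ) * C (-1 : ℤ) := by
    rw [Polynomial.Chebyshev.T_add_two, map_neg, map_one, map_ofNat]; ring
  rw [h1, resultant_add_mul_left _ _ _ _ _ (by rw [natDegree_C]; omega) hdn]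
  have hmul := resultant_mul_left (C (2 : ℤ) * Polynomial.X) (Polynomial.Chebyshev.T ℤ ((n : ℤ) + 1)) (Polynomial.Chebyshev.T ℤ (n : ℤ)) n hdn
  rw [natDegree_C_mul_X 2 two_ne_zero, hd1, show 1 + (n + 1) = n + 2 by ring] at hmul
  rw [hmul, resultant_C_mul_left, show (Polynomial.X : ℤ[X]) = Polynomial.X - C 0 by rw [map_zero, sub_zero], resultant_X_sub_C_left _ _ _ hdn, chebyshevT_resultant n]

/-- Odd index: `Res_{(2m+3,2m+1)}(T_{2m+3}, T_{2m+1}) = 0`. [this file, §1195] -/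
theorem chebyshevT_resultant_gap_two_odd (m : ℕ) :
    (Polynomial.Chebyshev.T ℤ (((2 * m + 1 : ℕ) : ℤ) + 2)).resultant (Polynomial.Chebyshev.T ℤ ((2 * m + 1 : ℕ) : ℤ)) (2 * m + 1 + 2) (2 * m + 1) = 0 := by
  rw [chebyshevT_resultant_gap_two (2 * m + 1), Polynomial.Chebyshev.T_eval_zero_of_odd (R := ℤ) (n := ((2 * m + 1 : ℕ) : ℤ)) ⟨m, by push_cast; ring⟩, mul_zero, zero_mul]

/-- Even index: `Res_{(2m+2,2m)}(T_{2m+2}, T_{2m}) = 2^{2m} (−1)^m · (−1)^{m(2m+1)} 2^{2m(2m−1)}` (`T_{2m}(0) = (−1)^m`). [this file, §1195] -/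
theorem chebyshevT_resultant_gap_two_even (m : ℕ) :
    (Polynomial.Chebyshev.T ℤ (((2 * m : ℕ) : ℤ) + 2)).resultant (Polynomial.Chebyshev.T ℤ ((2 * m : ℕ) : ℤ)) (2 * m + 2) (2 * m) =
      2 ^ (2 * m) * (-1) ^ m * ((-1) ^ (2 * m * (2 * m + 1) / 2) * 2 ^ (2 * m * (2 * m - 1))) := by
  rw [chebyshevT_resultant_gap_two (2 * m), show (((2 * m : ℕ) : ℤ)) = 2 * (m : ℤ) by push_cast; ring, Polynomial.Chebyshev.T_eval_two_mul_zero, Int.coe_negOnePow_natCast]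
  simp only [Int.cast_id]

/-- **`Res_{(n+2,n)}(U_{n+2}, U_n) = 2^n · U_n(0) · (−1)^{n(n+1)∕2} 2^{n(n+1)}`** over `ℤ`. [Dilcher–Stolarsky 2005 (second kind); this file, §1195] -/
theorem chebyshevU_resultant_gap_two (n : ℕ) :
    (Polynomial.Chebyshev.U ℤ ((n : ℤ) + 2)).resultant (Polynomial.Chebyshev.U ℤ (n : ℤ)) (n + 2) n =
      2 ^ n * (Polynomial.Chebyshev.U ℤ (n : ℤ)).eval 0 * ((-1) ^ (n * (n + 1) / 2) * 2 ^ (n * (n + 1))) := by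
  obtain ⟨hd1, -⟩ := chebyshevU_natDegree_coeff (n + 1)
  obtain ⟨hdn, -⟩ := chebyshevU_natDegree_coeff n
  push_cast at hd1
  have h1 : Polynomial.Chebyshev.U ℤ ((n : ℤ) + 2) = (C (2 : ℤ) * Polynomial.X) * Polynomial.Chebyshev.U ℤ ((n : ℤ) + 1) + Polynomial.Chebyshev.U ℤ (n : ℤ) * C (-1 : ℤ) := by
    rw [Polynomial.Chebyshev.U_add_two, map_neg, map_one, map_ofNat]; ring
  rw [h1, resultant_add_mul_left _ _ _ _ _ (by rw [natDegree_C]; omega) hdn.le]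
  have hmul := resultant_mul_left (C (2 : ℤ) * Polynomial.X) (Polynomial.Chebyshev.U ℤ ((n : ℤ) + 1)) (Polynomial.Chebyshev.U ℤ (n : ℤ)) n hdn.le
  rw [natDegree_C_mul_X 2 two_ne_zero, hd1, show 1 + (n + 1) = n + 2 by ring] at hmul
  rw [hmul, resultant_C_mul_left, show (Polynomial.X : ℤ[X]) = Polynomial.X - C 0 by rw [map_zero, sub_zero], resultant_X_sub_C_left _ _ _ hdn.le, chebyshevU_resultant n]

end Summit.Ventures.HSemireg.Wedge.HankelOuter
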